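import Mathlib
import Summits.Ventures.PercRepro2.Defs
import Summits.Ventures.PercRepro2.Harris
import Summits.Ventures.PercRepro2.Independence
import Summits.Ventures.PercRepro2.CoinDefs
import Summits.Ventures.PercRepro2.CoinReverse
import Summits.Ventures.PercRepro2.CoinStarDefs
import Summits.Ventures.PercRepro2.CoinLsmCoreDefs
import Summits.Ventures.PercRepro2.CoinLsmCoreU
import Summits.Ventures.PercRepro2.CoinCoreGate
import Summits.Ventures.PercRepro2.CoinTreeCore
import Summits.Ventures.PercRepro2.CoinTreeAncestor
import Summits.Ventures.PercRepro2.CoinOrTailAlg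
import Summits.Ventures.PercRepro2.CoinOrTailDefs
import Summits.Ventures.PercRepro2.CoinOrTailLsmDefs
import Summits.Ventures.PercRepro2.CoinOrTailLsmSums
import Summits.Ventures.PercRepro2.CoinOrTailBlockAlg
import Summits.Ventures.PercRepro2.CoinOrTailBlockSums
import Summits.Ventures.PercRepro2.CoinOrTailMixLsm
import Summits.Ventures.PercRepro2.CoinBlockTheoremII
import Summits.Ventures.PercRepro2.CoinBlockMeanOrder
import Summits.Ventures.PercRepro2.CoinLsmCoreSure
import Summits.Ventures.PercRepro2.CoinOrTailKDefs
import Summits.Ventures.PercRepro2.CoinOrTailKSums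
import Summits.Ventures.PercRepro2.CoinOrTailKAlg
import Summits.Ventures.PercRepro2.CoinOrTailCovCore
import Summits.Ventures.PercRepro2.CoinOrTailKCore
import Summits.Ventures.PercRepro2.CoinMixBlock
import Summits.Ventures.PercRepro2.CoinOrTailKOneAlg
import Summits.Ventures.PercRepro2.CoinOrTailKChainAlg
import Summits.Ventures.PercRepro2.CoinOrTailKChainFunctional

/-!
# Row 2′DARC at an OR-tail whose uncovered entries form a CHAIN — in particular ONE uncovered entry
(blind cell PercRepro2, night-2 g11; proofs/NIGHT2-DARC.md §43, §45)

`darc_of_orTailLsmKChain`: an OR-tail with the entry set `ent` on a log-supermodular core `U`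
(`OrTailK`), two markers `m₁, m₂ ∈ U` and a set `und ⊆ ent` of entries such that the markers COVER
the entries outside `und` (`hcov` on `ent \ und`) and the traces of `und` on the clusters of
positive probability form a chain (`hchain`), give `Φ_D({s ↛ t in D + (a → w)}) ≥ 0` at every
head.  COROLLARIES: `darc_of_orTailLsmKOne` / `darc_of_orTailLsmKOneDom` (ONE uncovered entry
`r₀`, NO condition on it — the three-route core `s → {p, q, r} → a` with the markers `p, q`, the
diamond with a background entry, the unrelated-marker core, §43) and the out-tree forms
`darc_of_orTailTreeKChain` (the uncovered entries all on ONE root path — an undominated branch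
with several arcs into the tail) and `darc_of_orTailTreeKOne`.

Proof: the mixed block theorem on the split by the OR of the coins of `und`
(`orTailKChain_functional_nonneg`), transported through `ClosedInCoreU.phiC_gate_eq` and
`OrTailK.sum_R_eq` / `sum_G_eq` exactly as in `darc_of_orTailLsmK`.
-/

namespace Summit.Ventures.PercRepro2.Coin

open Classical

section KOneMain

variable {V : Type*} {E : Type*} [Fintype V] [DecidableEq V] [Fintype E] [DecidableEq E]
  {R : Type*} [Field R] [LinearOrder R] [IsStrictOrderedRing R]
  {arcs : E → Finset (V × V)} {s : V} {U : Finset V} {ent : Finset V} {c : V → E} {a w : V}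

/-- **THEOREM (row 2′DARC at a k-entry OR-tail with a CHAIN of uncovered entries).**
`OrTailK arcs s U ent c a`, `SameEnds`, the cluster law of `U` log-supermodular (`hν`), markers
`m₁, m₂ ∈ U`, a set `und ⊆ ent` with the markers covering the entries outside `und` (`hcov`) and
the traces of `und` on the clusters of positive probability nested (`hchain`), `t, w ∉ U ∪ {a, s}`
⟹ `Φ_D({s ↛ t in D + (a → w)}) ≥ 0` for the markers `m₁, m₂` at every head. -/
theorem darc_of_orTailLsmKChain (pr : E → R) (hp : IsProbVec pr) (hS : SameEnds arcs)
    (h : OrTailK arcs s U ent c a) {m₁ m₂ : V} (hm₁ : m₁ ∈ U) (hm₂ : m₂ ∈ U) {und : Finset V}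
    (hund : und ⊆ ent)
    (hcov : ∀ W ⊆ U, m₁ ∉ W → m₂ ∉ W → (∃ r ∈ ent \ und, r ∈ W) →
      prob pr (coreLevel arcs s U W) = 0)
    (hchain : ∀ S ⊆ U, ∀ T ⊆ U, prob pr (coreLevel arcs s U S) ≠ 0 →
      prob pr (coreLevel arcs s U T) ≠ 0 →
      (∀ r ∈ und, r ∈ S → r ∈ T) ∨ (∀ r ∈ und, r ∈ T → r ∈ S))
    (hν : ∀ W W', W ⊆ U → W' ⊆ U →
      prob pr (coreLevel arcs s U W) * prob pr (coreLevel arcs s U W') ≤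
        prob pr (coreLevel arcs s U (W ∩ W')) * prob pr (coreLevel arcs s U (W ∪ W')))
    {t : V} (htC : t ∉ insert a U) (hts : t ≠ s) (hws : w ≠ s) (hwC : w ∉ insert a U) :
    DARC pr arcs s {t} m₁ m₂ a w := by
  have hC := h.closedInCoreU
  have hm₁a : m₁ ≠ a := fun e => h.a_notin (e ▸ hm₁)
  have hm₂a : m₂ ≠ a := fun e => h.a_notin (e ▸ hm₂)
  have hm₁C : m₁ ∈ insert a U := Finset.mem_insert_of_mem hm₁
  have hm₂C : m₂ ∈ insert a U := Finset.mem_insert_of_mem hm₂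
  have haC : a ∈ insert a U := Finset.mem_insert_self _ _
  unfold DARC
  rw [hC.phiC_gate_eq pr hS htC hts hm₁C hm₂C haC hws hwC]
  have hm1 : ∀ W : Finset V, (fun _ : Finset V => (1 : R)) (insert a W) = (fun _ => (1 : R)) W :=
    fun _ => rfl
  have hmp : ∀ W : Finset V, (fun W : Finset V => if m₁ ∈ W then (1 : R) else 0) (insert a W) =
      (fun W : Finset V => if m₁ ∈ W then (1 : R) else 0) W := by
    intro W; simp only [Finset.mem_insert, hm₁a, false_or]
  have hmq : ∀ W : Finset V, (fun W : Finset V => if m₂ ∈ W then (1 : R) else 0) (insert a W) =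
      (fun W : Finset V => if m₂ ∈ W then (1 : R) else 0) W := by
    intro W; simp only [Finset.mem_insert, hm₂a, false_or]
  have hmpq : ∀ W : Finset V,
      (fun W : Finset V => (if m₁ ∈ W then (1 : R) else 0) * (if m₂ ∈ W then (1 : R) else 0))
        (insert a W) =
      (fun W : Finset V => (if m₁ ∈ W then (1 : R) else 0) * (if m₂ ∈ W then (1 : R) else 0)) W := by
    intro W; simp only [Finset.mem_insert, hm₁a, hm₂a, false_or]
  have eΛ := h.sum_R_eq pr t (fun _ => (1 : R)) hm1
  have eFa := h.sum_R_eq pr t (fun W => if m₁ ∈ W then (1 : R) else 0) hmp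
  have eFb := h.sum_R_eq pr t (fun W => if m₂ ∈ W then (1 : R) else 0) hmq
  have eM := h.sum_G_eq (w := w) pr t (fun _ => (1 : R)) hm1
  have eX := h.sum_G_eq (w := w) pr t (fun W => if m₁ ∈ W then (1 : R) else 0) hmp
  have eY := h.sum_G_eq (w := w) pr t (fun W => if m₂ ∈ W then (1 : R) else 0) hmq
  have eXY := h.sum_G_eq (w := w) pr t
    (fun W => (if m₁ ∈ W then (1 : R) else 0) * (if m₂ ∈ W then (1 : R) else 0)) hmpq
  simp only [mul_one] at eΛ eM
  rw [eΛ, eFa, eFb, eM, eX, eY, eXY]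
  obtain ⟨hA0, hAmono, hAlsm⟩ := OrTailU.head_props (U := U) (a := a) pr hp hS t
  exact orTailKChain_functional_nonneg U (fun W => prob pr (coreLevel arcs s U W))
    (fun X => prob pr (coreAvoidEvent arcs s t (insert a U) X)) pr ent c m₁ m₂ a w hund
    hp.nonneg hp.le_one (fun W => prob_nonneg hp _) (fun s' hs' t' ht' => hν s' t' hs' ht')
    hcov hchain hA0 hAlsm hAmono

/-- **COROLLARY (ONE uncovered entry).**  A distinguished entry `r₀ ∈ ent` with the markers covering
the OTHER entries (`hcov` on `ent.erase r₀`) and NO condition on `r₀` — the three-route core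
`s → {p, q, r} → a` with the markers `p, q`, the diamond with a background entry, the
unrelated-marker core (§43). -/
theorem darc_of_orTailLsmKOne (pr : E → R) (hp : IsProbVec pr) (hS : SameEnds arcs)
    (h : OrTailK arcs s U ent c a) {m₁ m₂ : V} (hm₁ : m₁ ∈ U) (hm₂ : m₂ ∈ U) {r₀ : V}
    (hr₀ : r₀ ∈ ent)
    (hcov : ∀ W ⊆ U, m₁ ∉ W → m₂ ∉ W → (∃ r ∈ ent.erase r₀, r ∈ W) →
      prob pr (coreLevel arcs s U W) = 0)
    (hν : ∀ W W', W ⊆ U → W' ⊆ U →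
      prob pr (coreLevel arcs s U W) * prob pr (coreLevel arcs s U W') ≤
        prob pr (coreLevel arcs s U (W ∩ W')) * prob pr (coreLevel arcs s U (W ∪ W')))
    {t : V} (htC : t ∉ insert a U) (hts : t ≠ s) (hws : w ≠ s) (hwC : w ∉ insert a U) :
    DARC pr arcs s {t} m₁ m₂ a w := by
  refine darc_of_orTailLsmKChain pr hp hS h hm₁ hm₂ (Finset.singleton_subset_iff.2 hr₀) ?_ ?_ hν
    htC hts hws hwC
  · intro W hW hm₁W hm₂W he
    rw [Finset.sdiff_singleton_eq_erase] at he
    exact hcov W hW hm₁W hm₂W he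
  · intro S _ T _ _ _
    by_cases hT : r₀ ∈ T
    · left
      intro r hr _
      rw [Finset.mem_singleton] at hr
      exact hr ▸ hT
    · right
      intro r hr hrT
      rw [Finset.mem_singleton] at hr
      exact absurd (hr ▸ hrT) hT

/-- **COROLLARY (every entry but `r₀` dominated by one of the markers).** -/
theorem darc_of_orTailLsmKOneDom (pr : E → R) (hp : IsProbVec pr) (hS : SameEnds arcs)
    (h : OrTailK arcs s U ent c a) {m₁ m₂ : V} (hm₁ : m₁ ∈ U) (hm₂ : m₂ ∈ U) {r₀ : V}
    (hr₀ : r₀ ∈ ent)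
    (hdom : ∀ r ∈ ent, r ≠ r₀ →
      (∀ W ⊆ U, r ∈ W → m₁ ∉ W → prob pr (coreLevel arcs s U W) = 0) ∨
      (∀ W ⊆ U, r ∈ W → m₂ ∉ W → prob pr (coreLevel arcs s U W) = 0))
    (hν : ∀ W W', W ⊆ U → W' ⊆ U →
      prob pr (coreLevel arcs s U W) * prob pr (coreLevel arcs s U W') ≤
        prob pr (coreLevel arcs s U (W ∩ W')) * prob pr (coreLevel arcs s U (W ∪ W')))
    {t : V} (htC : t ∉ insert a U) (hts : t ≠ s) (hws : w ≠ s) (hwC : w ∉ insert a U) :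
    DARC pr arcs s {t} m₁ m₂ a w := by
  refine darc_of_orTailLsmKOne pr hp hS h hm₁ hm₂ hr₀ ?_ hν htC hts hws hwC
  intro W hW hm₁W hm₂W ⟨r, hr, hrW⟩
  obtain ⟨hrr₀, hr⟩ := Finset.mem_erase.1 hr
  rcases hdom r hr hrr₀ with hd | hd
  · exact hd W hW hrW hm₁W
  · exact hd W hW hrW hm₂W

/-- **COROLLARY (an out-tree, the uncovered entries on ONE root path).**  `U` an out-tree core, the
tail entered from the entries `ent`, every entry outside `und` having `m₁` or `m₂` among its
ancestors, and the entries of `und` pairwise comparable by ancestry (all on one root path): row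
2′DARC at `a → w` for the markers `m₁, m₂` at every head — an undominated BRANCH with any number
of arcs into the tail. -/
theorem darc_of_orTailTreeKChain (pr : E → R) (hp : IsProbVec pr) (hS : SameEnds arcs)
    (h : OrTailK arcs s U ent c a) {c' : V → E} {par : V → V} {rk : V → ℕ}
    (hT : TreeCore arcs s U c' par rk) {m₁ m₂ : V} (hm₁ : m₁ ∈ U) (hm₂ : m₂ ∈ U)
    {und : Finset V} (hund : und ⊆ ent)
    (hanc : ∀ r ∈ ent, r ∉ und → IsAncestorIn U par r m₁ ∨ IsAncestorIn U par r m₂)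
    (hlin : ∀ r ∈ und, ∀ r' ∈ und, IsAncestorIn U par r r' ∨ IsAncestorIn U par r' r)
    {t : V} (htC : t ∉ insert a U) (hts : t ≠ s) (hws : w ≠ s) (hwC : w ∉ insert a U) :
    DARC pr arcs s {t} m₁ m₂ a w := by
  refine darc_of_orTailLsmKChain pr hp hS h hm₁ hm₂ hund ?_ ?_ (hT.coreLevel_lsm pr hp) htC hts
    hws hwC
  · intro W hW hm₁W hm₂W ⟨r, hr, hrW⟩
    obtain ⟨hr, hru⟩ := Finset.mem_sdiff.1 hr
    rcases hanc r hr hru with ha | ha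
    · rw [hT.coreLevel_eq_empty_of_ancestor (h.ent_sub hr) hm₁ ha hrW hm₁W, prob_empty]
    · rw [hT.coreLevel_eq_empty_of_ancestor (h.ent_sub hr) hm₂ ha hrW hm₂W, prob_empty]
  · intro S _ T _ hS0 hT0
    by_contra hne
    push Not at hne
    obtain ⟨⟨r, hr, hrS, hrT⟩, ⟨r', hr', hr'T, hr'S⟩⟩ := hne
    rcases hlin r hr r' hr' with hh | hh
    · exact hS0 (by
        rw [hT.coreLevel_eq_empty_of_ancestor (h.ent_sub (hund hr)) (h.ent_sub (hund hr')) hh hrS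
          hr'S, prob_empty])
    · exact hT0 (by
        rw [hT.coreLevel_eq_empty_of_ancestor (h.ent_sub (hund hr')) (h.ent_sub (hund hr)) hh hr'T
          hrT, prob_empty])

/-- **COROLLARY (an out-tree, ALL entries on ONE root path, ANY two markers).**  When the tail
is fed only from the vertices of a single branch (the entries pairwise comparable by ancestry),
no marker needs to cover anything: row 2′DARC at `a → w` for ANY markers `m₁, m₂ ∈ U`. -/
theorem darc_of_orTailTreeKPath (pr : E → R) (hp : IsProbVec pr) (hS : SameEnds arcs)
    (h : OrTailK arcs s U ent c a) {c' : V → E} {par : V → V} {rk : V → ℕ}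
    (hT : TreeCore arcs s U c' par rk) {m₁ m₂ : V} (hm₁ : m₁ ∈ U) (hm₂ : m₂ ∈ U)
    (hlin : ∀ r ∈ ent, ∀ r' ∈ ent, IsAncestorIn U par r r' ∨ IsAncestorIn U par r' r)
    {t : V} (htC : t ∉ insert a U) (hts : t ≠ s) (hws : w ≠ s) (hwC : w ∉ insert a U) :
    DARC pr arcs s {t} m₁ m₂ a w :=
  darc_of_orTailTreeKChain pr hp hS h hT hm₁ hm₂ (Finset.Subset.refl ent)
    (fun _ hr hru => absurd hr hru) hlin htC hts hws hwC

/-- **COROLLARY (an out-tree, every entry but `r₀` below one of the markers).**  `U` an out-tree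
core, the tail entered from the entries `ent`, each entry other than `r₀` having `m₁` or `m₂`
among its ancestors (or being one of them), the entry `r₀` ANYWHERE in the tree — e.g. the
three-route core `s → {p, q, r} → a` with the markers `p, q`: row 2′DARC at `a → w` for the
markers `m₁, m₂` at every head. -/
theorem darc_of_orTailTreeKOne (pr : E → R) (hp : IsProbVec pr) (hS : SameEnds arcs)
    (h : OrTailK arcs s U ent c a) {c' : V → E} {par : V → V} {rk : V → ℕ}
    (hT : TreeCore arcs s U c' par rk) {m₁ m₂ : V} (hm₁ : m₁ ∈ U) (hm₂ : m₂ ∈ U) {r₀ : V}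
    (hr₀ : r₀ ∈ ent)
    (hanc : ∀ r ∈ ent, r ≠ r₀ → IsAncestorIn U par r m₁ ∨ IsAncestorIn U par r m₂)
    {t : V} (htC : t ∉ insert a U) (hts : t ≠ s) (hws : w ≠ s) (hwC : w ∉ insert a U) :
    DARC pr arcs s {t} m₁ m₂ a w := by
  refine darc_of_orTailLsmKOneDom pr hp hS h hm₁ hm₂ hr₀ ?_ (hT.coreLevel_lsm pr hp) htC hts hws
    hwC
  intro r hr hrr₀
  rcases hanc r hr hrr₀ with ha | ha
  · left
    intro W _ hrW hmW
    rw [hT.coreLevel_eq_empty_of_ancestor (h.ent_sub hr) hm₁ ha hrW hmW, prob_empty]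
  · right
    intro W _ hrW hmW
    rw [hT.coreLevel_eq_empty_of_ancestor (h.ent_sub hr) hm₂ ha hrW hmW, prob_empty]

end KOneMain


end Summit.Ventures.PercRepro2.Coin
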